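import Summits.CriticalPhenomena.CardyFormulaZ2.Theorems.CardyComplexConeSLESixFamiliesGiveCardyDefs
import Mathlib.Analysis.Calculus.MeanValue
import Mathlib.Analysis.Calculus.ContDiff.Defs
import Mathlib.Analysis.Calculus.Deriv.Comp
import HarnessLib

/-!
# drefute gen-7 — registered helper `smoothMark_part7` (STUB F, part 7/10): candidate proof

`smoothMark_part7` (registered 2026-08-16T05:17Z): a smooth mark (`IsSmoothMark D i`) admits a lattice
FRAME `U = Site.toComplex (Pi.single k s)`, `V = Site.toComplex (Pi.single k.rev t)` (`s, t = ±1`) in which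
the domain near `D.pt i = α U + G α V` is the strict epigraph `{a U + b V : G a < b}` of a GLOBALLY monotone,
`1`-Lipschitz function `G`, differentiable within `R` of `α`.

Construction (paper check of gen-6 §3b made formal): from the `IsSmoothMark` chart `(e, g, r)` take the
orientation sign `σ = ±1` making `u ↦ g (σ u)` increasing near `0` (general position: sign of `g′ 0`,
by continuity of `g′`; affine `g = c·x`: `σ = c` if `c = ±1`, `σ = 1` if `c = 0`), CLAMP the argument to
`[-ρ, ρ]` (`ρ = r′/2`, `r′` a radius of sign constancy with `|g′| < 1`) to get a global monotone
`1`-Lipschitz `H` agreeing with `g (σ ·)` on `(-ρ, ρ)`, and put `U = σ e`, `V = e I`,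
`α = σ re (e⁻¹ pt i)`, `β = im (e⁻¹ pt i)`, `G a = β + H (a - α)`, `R = ρ`.
-/

noncomputable section

open Set Metric
open Literature.Probability Literature.Probability.RandomPlanarGeometry
  Literature.Probability.LatticeModels

namespace Summit.CriticalPhenomena.CardyFormulaZ2.Cruxes.SLESixFamiliesGiveCardy.CollarTouchSandwich
namespace DrefuteG7

/-- The clamp to `[-ρ, ρ]`. -/
def clamp (ρ u : ℝ) : ℝ := max (-ρ) (min ρ u)

theorem clamp_mem {ρ : ℝ} (hρ : 0 ≤ ρ) (u : ℝ) : clamp ρ u ∈ Icc (-ρ) ρ :=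
  ⟨le_max_left _ _, max_le (by linarith) (min_le_left _ _)⟩

theorem clamp_eq_self {ρ u : ℝ} (hu : |u| < ρ) : clamp ρ u = u := by
  rw [abs_lt] at hu
  simp only [clamp, min_eq_right hu.2.le, max_eq_right hu.1.le]

theorem clamp_mono (ρ : ℝ) : Monotone (clamp ρ) := fun _ _ h =>
  max_le_max le_rfl (min_le_min le_rfl h)

theorem lipschitz_clamp (ρ : ℝ) : LipschitzWith 1 (clamp ρ) :=
  (LipschitzWith.id.const_min ρ).const_max (-ρ)

theorem abs_clamp_sub_clamp_le (ρ u v : ℝ) : |clamp ρ u - clamp ρ v| ≤ |u - v| := by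
  have h := (lipschitz_clamp ρ).dist_le_mul u v
  simpa [Real.dist_eq] using h

/-- Clamping a function which is monotone and `1`-Lipschitz on `[-ρ, ρ]` gives a globally monotone
`1`-Lipschitz function agreeing with it on `(-ρ, ρ)`. -/
theorem clamp_spec {ρ : ℝ} (hρ : 0 < ρ) {F : ℝ → ℝ} (hFm : MonotoneOn F (Icc (-ρ) ρ))
    (hFl : ∀ u ∈ Icc (-ρ) ρ, ∀ v ∈ Icc (-ρ) ρ, |F u - F v| ≤ |u - v|)
    (hFd : ∀ u, |u| < ρ → DifferentiableAt ℝ F u) :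
    Monotone (fun u => F (clamp ρ u)) ∧ (∀ u v, |F (clamp ρ u) - F (clamp ρ v)| ≤ |u - v|) ∧
      (∀ u, |u| < ρ → F (clamp ρ u) = F u) ∧
      (∀ u, |u| < ρ → DifferentiableAt ℝ (fun u => F (clamp ρ u)) u) := by
  refine ⟨fun u v h => hFm (clamp_mem hρ.le u) (clamp_mem hρ.le v) (clamp_mono ρ h), fun u v =>
    (hFl _ (clamp_mem hρ.le u) _ (clamp_mem hρ.le v)).trans (abs_clamp_sub_clamp_le ρ u v),
    fun u hu => by rw [clamp_eq_self hu], fun u hu => ?_⟩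
  have hev : (fun u => F (clamp ρ u)) =ᶠ[nhds u] F := by
    have hmem : Ioo (-ρ) ρ ∈ nhds u := isOpen_Ioo.mem_nhds (by rw [abs_lt] at hu; exact hu)
    filter_upwards [hmem] with v hv
    rw [clamp_eq_self (abs_lt.2 hv)]
  exact (hFd u hu).congr_of_eventuallyEq hev

/-- **Analytic core, general position.** -/
theorem core_general {g : ℝ → ℝ} {r : ℝ} (hr : 0 < r) (hg : ContDiffOn ℝ 2 g (Ioo (-r) r))
    (h0 : 0 < |deriv g 0|) (h1 : |deriv g 0| < 1) :
    ∃ (σ ρ : ℝ) (H : ℝ → ℝ), (σ = 1 ∨ σ = -1) ∧ 0 < ρ ∧ ρ ≤ r ∧ Monotone H ∧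
      (∀ u v, |H u - H v| ≤ |u - v|) ∧ (∀ u, |u| < ρ → H u = g (σ * u)) ∧
      (∀ u, |u| < ρ → DifferentiableAt ℝ H u) := by
  have hdiff : DifferentiableOn ℝ g (Ioo (-r) r) := hg.differentiableOn (by norm_num)
  have hcont : ContinuousOn (deriv g) (Ioo (-r) r) := hg.continuousOn_deriv_of_isOpen isOpen_Ioo (by norm_num)
  have h0mem : (0 : ℝ) ∈ Ioo (-r) r := ⟨by linarith, hr⟩
  have hc0 : ContinuousAt (deriv g) 0 := hcont.continuousAt (isOpen_Ioo.mem_nhds h0mem)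
  -- orientation sign
  obtain ⟨σ, hσ, hσd⟩ : ∃ σ : ℝ, (σ = 1 ∨ σ = -1) ∧ σ * deriv g 0 = |deriv g 0| := by
    by_cases hpos : 0 ≤ deriv g 0
    · exact ⟨1, Or.inl rfl, by rw [abs_of_nonneg hpos, one_mul]⟩
    · exact ⟨-1, Or.inr rfl, by rw [abs_of_neg (lt_of_not_ge hpos)]; ring⟩
  have hσabs : |σ| = 1 := by rcases hσ with rfl | rfl <;> norm_num
  have hσ2 : σ * σ = 1 := by rcases hσ with rfl | rfl <;> norm_num
  -- radius of sign constancy with `|g′| < 1`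
  set ε : ℝ := min (|deriv g 0|) (1 - |deriv g 0|) with hε
  have hεpos : 0 < ε := lt_min h0 (by linarith)
  obtain ⟨d, hd, hdε⟩ := Metric.continuousAt_iff.1 hc0 ε hεpos
  set r' : ℝ := min d r with hr'
  have hr'pos : 0 < r' := lt_min hd hr
  have hr'r : r' ≤ r := min_le_right _ _
  have hder : ∀ v : ℝ, |v| < r' → 0 < σ * deriv g v ∧ |deriv g v| < 1 := by
    intro v hv
    have hvd : dist v 0 < d := by rw [Real.dist_eq, sub_zero]; exact hv.trans_le (min_le_left _ _)
    have h := hdε hvd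
    rw [Real.dist_eq] at h
    have hε1 : ε ≤ |deriv g 0| := min_le_left _ _
    have hε2 : ε ≤ 1 - |deriv g 0| := min_le_right _ _
    have hσv : |σ * (deriv g v - deriv g 0)| < ε := by rw [abs_mul, hσabs, one_mul]; exact h
    constructor
    · have := neg_abs_le (σ * (deriv g v - deriv g 0))
      nlinarith
    · have := abs_sub_abs_le_abs_sub (deriv g v) (deriv g 0)
      linarith
  -- the increasing branch `F v = g (σ v)` on `[-ρ, ρ]`, `ρ = r'/2`
  set ρ : ℝ := r' / 2 with hρ
  have hρpos : 0 < ρ := by positivity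
  have hρr' : ρ < r' := by rw [hρ]; linarith
  set F : ℝ → ℝ := fun v => g (σ * v) with hF
  have hgd : ∀ v : ℝ, |v| < r' → HasDerivAt g (deriv g (σ * v)) (σ * v) := by
    intro v hv
    have hmem : σ * v ∈ Ioo (-r) r := by
      have : |σ * v| < r := by rw [abs_mul, hσabs, one_mul]; exact hv.trans_le hr'r
      exact ⟨(abs_lt.1 this).1, (abs_lt.1 this).2⟩
    exact (hdiff.differentiableAt (isOpen_Ioo.mem_nhds hmem)).hasDerivAt
  have hFd : ∀ v : ℝ, |v| < r' → HasDerivAt F (deriv g (σ * v) * σ) v := by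
    intro v hv
    have hlin : HasDerivAt (fun u : ℝ => σ * u) σ v := by
      simpa using (hasDerivAt_id v).const_mul σ
    exact (hgd v hv).comp v hlin
  have hIcc : ∀ v ∈ Icc (-ρ) ρ, |v| < r' := fun v hv => (abs_le.2 ⟨hv.1, hv.2⟩).trans_lt hρr'
  have hFm : MonotoneOn F (Icc (-ρ) ρ) := by
    refine monotoneOn_of_deriv_nonneg (convex_Icc _ _)
      (fun v hv => (hFd v (hIcc v hv)).continuousAt.continuousWithinAt)
      (fun v hv => ((hFd v (hIcc v (interior_subset hv))).differentiableAt).differentiableWithinAt)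
      fun v hv => ?_
    have hv := hIcc v (interior_subset hv)
    rw [(hFd v hv).deriv]
    have hsv : |σ * v| < r' := by rw [abs_mul, hσabs, one_mul]; exact hv
    nlinarith [(hder (σ * v) hsv).1]
  have hFl : ∀ u ∈ Icc (-ρ) ρ, ∀ v ∈ Icc (-ρ) ρ, |F u - F v| ≤ |u - v| := by
    intro u hu v hv
    have key := (convex_Icc (-ρ) ρ).norm_image_sub_le_of_norm_deriv_le (𝕜 := ℝ) (f := F) (C := 1)
      (fun w hw => (hFd w (hIcc w hw)).differentiableAt) (fun w hw => ?_) hv hu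
    · simpa [Real.norm_eq_abs] using key
    · have hw' := hIcc w hw
      rw [(hFd w hw').deriv, Real.norm_eq_abs, abs_mul, hσabs, mul_one]
      have hsw : |σ * w| < r' := by rw [abs_mul, hσabs, one_mul]; exact hw'
      exact (hder (σ * w) hsw).2.le
  have hFd' : ∀ u, |u| < ρ → DifferentiableAt ℝ F u := fun u hu =>
    (hFd u (hu.trans hρr')).differentiableAt
  obtain ⟨hm, hl, hg', hd'⟩ := clamp_spec hρpos hFm hFl hFd'
  exact ⟨σ, ρ, fun u => F (clamp ρ u), hσ, hρpos, by linarith, hm, hl,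
    fun u hu => by show F (clamp ρ u) = g (σ * u); rw [hg' u hu], hd'⟩

/-- **Analytic core, affine case.** -/
theorem core_affine {g : ℝ → ℝ} {r : ℝ} (hr : 0 < r) {c : ℝ} (hc : c = 0 ∨ c = 1 ∨ c = -1)
    (hg : ∀ t, g t = c * t) :
    ∃ (σ ρ : ℝ) (H : ℝ → ℝ), (σ = 1 ∨ σ = -1) ∧ 0 < ρ ∧ ρ ≤ r ∧ Monotone H ∧
      (∀ u v, |H u - H v| ≤ |u - v|) ∧ (∀ u, |u| < ρ → H u = g (σ * u)) ∧
      (∀ u, |u| < ρ → DifferentiableAt ℝ H u) := by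
  rcases hc with rfl | rfl | rfl
  · refine ⟨1, r, fun _ => 0, Or.inl rfl, hr, le_rfl, fun _ _ _ => le_rfl, fun u v => by simp,
      fun u _ => by simp [hg], fun u _ => differentiableAt_const _⟩
  · refine ⟨1, r, fun u => u, Or.inl rfl, hr, le_rfl, fun _ _ h => h, fun u v => le_rfl,
      fun u _ => by simp [hg], fun u _ => differentiableAt_id⟩
  · refine ⟨-1, r, fun u => u, Or.inr rfl, hr, le_rfl, fun _ _ h => h, fun u v => le_rfl,
      fun u _ => by simp [hg], fun u _ => differentiableAt_id⟩


/-- **Frame bookkeeping**: `σ e` and `e I` are lattice frame vectors for `e ∈ {1, I, -1, -I}`, `σ = ±1`. -/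
theorem frame_of_e {e : ℂ} (he : e = 1 ∨ e = Complex.I ∨ e = -1 ∨ e = -Complex.I) {σ : ℝ}
    (hσ : σ = 1 ∨ σ = -1) :
    ∃ (k : Fin 2) (s t : ℤ), (s = 1 ∨ s = -1) ∧ (t = 1 ∨ t = -1) ∧
      Site.toComplex (Pi.single k s) = (σ : ℂ) * e ∧ Site.toComplex (Pi.single k.rev t) = e * Complex.I := by
  have hrev0 : (0 : Fin 2).rev = 1 := by decide
  have hrev1 : (1 : Fin 2).rev = 0 := by decide
  rcases he with rfl | rfl | rfl | rfl <;> rcases hσ with rfl | rfl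
  · exact ⟨0, 1, 1, Or.inl rfl, Or.inl rfl, by apply Complex.ext <;> simp [Site.toComplex],
      by apply Complex.ext <;> simp [Site.toComplex, hrev0]⟩
  · exact ⟨0, -1, 1, Or.inr rfl, Or.inl rfl, by apply Complex.ext <;> simp [Site.toComplex],
      by apply Complex.ext <;> simp [Site.toComplex, hrev0]⟩
  · exact ⟨1, 1, -1, Or.inl rfl, Or.inr rfl, by apply Complex.ext <;> simp [Site.toComplex],
      by apply Complex.ext <;> simp [Site.toComplex, hrev1]⟩
  · exact ⟨1, -1, -1, Or.inr rfl, Or.inr rfl, by apply Complex.ext <;> simp [Site.toComplex],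
      by apply Complex.ext <;> simp [Site.toComplex, hrev1]⟩
  · exact ⟨0, -1, -1, Or.inr rfl, Or.inr rfl, by apply Complex.ext <;> simp [Site.toComplex],
      by apply Complex.ext <;> simp [Site.toComplex, hrev0]⟩
  · exact ⟨0, 1, -1, Or.inl rfl, Or.inr rfl, by apply Complex.ext <;> simp [Site.toComplex],
      by apply Complex.ext <;> simp [Site.toComplex, hrev0]⟩
  · exact ⟨1, -1, 1, Or.inr rfl, Or.inl rfl, by apply Complex.ext <;> simp [Site.toComplex],
      by apply Complex.ext <;> simp [Site.toComplex, hrev1]⟩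
  · exact ⟨1, 1, 1, Or.inl rfl, Or.inl rfl, by apply Complex.ext <;> simp [Site.toComplex],
      by apply Complex.ext <;> simp [Site.toComplex, hrev1]⟩

/-- **`smoothMark_part7` verbatim (registered signature).** -/
theorem smoothMark_part7_proof : ∀ (D : DobrushinDomain) (i : Fin 2), IsSmoothMark D i → ∃ (k : Fin 2) (s t : ℤ) (U V : ℂ) (G : ℝ → ℝ) (α R : ℝ), (s = 1 ∨ s = -1) ∧ (t = 1 ∨ t = -1) ∧ U = Site.toComplex (Pi.single k s) ∧ V = Site.toComplex (Pi.single k.rev t) ∧ D.pt i = (α : ℂ) * U + ((G α : ℝ) : ℂ) * V ∧ 0 < R ∧ Monotone G ∧ (∀ a b, |G a - G b| ≤ |a - b|) ∧ (∀ a b : ℝ, dist ((a : ℂ) * U + (b : ℂ) * V) (D.pt i) < R → ((a : ℂ) * U + (b : ℂ) * V ∈ D.carrier ↔ G a < b)) ∧ (∀ c, |c - α| < R → DifferentiableAt ℝ G c) := by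
  intro D i hsm
  obtain ⟨e, g, r, he, hr, hg2, hg0, hcase, hchart⟩ := hsm
  obtain ⟨σ, ρ, H, hσ, hρ, hρr, hHm, hHl, hHg, hHd⟩ :
      ∃ (σ ρ : ℝ) (H : ℝ → ℝ), (σ = 1 ∨ σ = -1) ∧ 0 < ρ ∧ ρ ≤ r ∧ Monotone H ∧
        (∀ u v, |H u - H v| ≤ |u - v|) ∧ (∀ u, |u| < ρ → H u = g (σ * u)) ∧
        (∀ u, |u| < ρ → DifferentiableAt ℝ H u) := by
    rcases hcase with ⟨h0, h1⟩ | ⟨c, hc, hgc⟩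
    · exact core_general hr hg2 h0 h1
    · exact core_affine hr hc hgc
  obtain ⟨k, s, t, hs, ht, hUe, hVe⟩ := frame_of_e he hσ
  -- unit facts about `e` and `σ`
  have he1 : ‖e‖ = 1 := by rcases he with rfl | rfl | rfl | rfl <;> simp
  have he0 : e ≠ 0 := fun h => by rw [h, norm_zero] at he1; exact zero_ne_one he1
  have hσabs : |σ| = 1 := by rcases hσ with rfl | rfl <;> norm_num
  have hσ2 : σ * σ = 1 := by rcases hσ with rfl | rfl <;> norm_num
  -- coordinates of the mark: `pt i = e w₀`, `w₀ = σ α + β I`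
  set w₀ : ℂ := e⁻¹ * D.pt i with hw₀
  set α : ℝ := σ * w₀.re with hα
  set β : ℝ := w₀.im with hβ
  have hσα : σ * α = w₀.re := by rw [hα, ← mul_assoc, hσ2, one_mul]
  have hw₀' : w₀ = ((σ * α : ℝ) : ℂ) + (β : ℂ) * Complex.I := by
    rw [hσα, hβ]; exact (Complex.re_add_im w₀).symm
  have hpt : D.pt i = e * w₀ := by rw [hw₀, ← mul_assoc, mul_inv_cancel₀ he0, one_mul]
  set U : ℂ := (σ : ℂ) * e with hU
  set V : ℂ := e * Complex.I with hV
  set G : ℝ → ℝ := fun a => β + H (a - α) with hG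
  have hH0 : H 0 = 0 := by rw [hHg 0 (by simp [hρ]), mul_zero, hg0]
  have hGα : G α = β := by simp [hG, hH0]
  -- every frame point is `pt i + e w` with `w = σ (a - α) + (b - β) I`, `‖w‖ = dist`
  have hframe : ∀ a b : ℝ, (a : ℂ) * U + (b : ℂ) * V =
      D.pt i + e * (((σ * (a - α) : ℝ) : ℂ) + ((b - β : ℝ) : ℂ) * Complex.I) := by
    intro a b
    rw [hpt, hw₀', hU, hV]
    push_cast
    ring
  have hdist : ∀ a b : ℝ, dist ((a : ℂ) * U + (b : ℂ) * V) (D.pt i) =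
      ‖(((σ * (a - α) : ℝ) : ℂ) + ((b - β : ℝ) : ℂ) * Complex.I)‖ := by
    intro a b
    rw [dist_eq_norm, hframe a b, add_sub_cancel_left, norm_mul, he1, one_mul]
  have hre : ∀ a b : ℝ, (((σ * (a - α) : ℝ) : ℂ) + ((b - β : ℝ) : ℂ) * Complex.I).re = σ * (a - α) := by
    intro a b; simp
  have him : ∀ a b : ℝ, (((σ * (a - α) : ℝ) : ℂ) + ((b - β : ℝ) : ℂ) * Complex.I).im = b - β := by
    intro a b; simp
  refine ⟨k, s, t, U, V, G, α, ρ, hs, ht, hUe.symm, hVe.symm, ?_, hρ, ?_, ?_, ?_, ?_⟩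
  · -- the mark
    rw [hGα]
    have h := hframe α β
    simp only [sub_self, mul_zero, Complex.ofReal_zero, zero_mul, add_zero, mul_zero] at h
    exact h.symm
  · -- monotone
    intro a b hab
    simp only [hG]
    linarith [hHm (sub_le_sub_right hab α)]
  · -- Lipschitz
    intro a b
    simp only [hG]
    calc |β + H (a - α) - (β + H (b - α))| = |H (a - α) - H (b - α)| := by congr 1; ring
      _ ≤ |a - α - (b - α)| := hHl _ _
      _ = |a - b| := by congr 1; ring
  · -- the chart
    intro a b hab
    have hwn : ‖(((σ * (a - α) : ℝ) : ℂ) + ((b - β : ℝ) : ℂ) * Complex.I)‖ < ρ := by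
      rw [← hdist a b]; exact hab
    have haα : |a - α| < ρ := by
      have h1 := Complex.abs_re_le_norm (((σ * (a - α) : ℝ) : ℂ) + ((b - β : ℝ) : ℂ) * Complex.I)
      rw [hre, abs_mul, hσabs, one_mul] at h1
      exact h1.trans_lt hwn
    rw [hframe a b, hchart _ (hwn.trans_le hρr), hre, him]
    simp only [hG]
    rw [hHg (a - α) haα]
    constructor <;> intro h <;> linarith
  · -- differentiability
    intro c hc
    simp only [hG]
    have h1 : DifferentiableAt ℝ (fun a : ℝ => H (a - α)) c := by
      have := (hHd (c - α) hc).comp c (differentiableAt_id.sub_const α)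
      simpa [Function.comp_def] using this
    exact h1.const_add β

end DrefuteG7
end Summit.CriticalPhenomena.CardyFormulaZ2.Cruxes.SLESixFamiliesGiveCardy.CollarTouchSandwich

end
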